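import Literature.AnabelianGeometry.AbsoluteAnabelian.AbsTopIII.Reconstruction
import Literature.AnabelianGeometry.AbsoluteAnabelian.FundamentalExtensionRestrictionConj
import HarnessLib

/-!
# [AbsTopIII] Theorem 1.9 WITH its functoriality clause (comparison form): the strengthened named fact `Thm_1_9'`

S. Mochizuki, *Topics in Absolute Anabelian Geometry III: Global Reconstruction Algorithms*, J. Math. Sci. Univ.
Tokyo **22** (2015) 939–1156 [cite: MochizukiAbsTopIII2015, Thm 1.9 pp.37-38] (author's manuscript pagination, as
in `Reconstruction.lean`; journal pp. 986–988): Thm. 1.9 «Then there exists a functorial "group-theoretic" algorithm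
(cf. Remark 1.9.8 below for more on the meaning of this terminology) for reconstructing the "NF-portion of the
function field" of `X` from the extension of profinite groups `1 → Δ_X → Π_X → G_k → 1`» (p. 37 = journal
p. 987) … «Finally, the asserted "functoriality" is with respect to arbitrary open injective homomorphisms of
extensions of profinite groups (cf. also Remark 1.10.1 below), as well as with respect to homomorphisms of
extensions of profinite groups arising from a base-change of the base field (i.e., `k`)» (p. 38 = journal
p. 988); Rmk. 1.9.5 (i) p. 39 (= journal p. 990): «the functoriality with respect to isomorphisms of the algorithm
of Theorem 1.9 may be regarded as yielding a new proof of the "profinite absolute version of the Grothendieck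
Conjecture over number fields"».

## Why this file exists (abc-iut cell, ERRATA-L5 X-143; GAP B later tranche row GB-17, RULINGS #352/#354/#356/#357;
## design memo of record `pub/ideators/abc-iut-inv-2/X143-CURE-DESIGN.md` v0.3 sha16 abfa469e185ddc38, §(i)/(ii))

`AbsTopIII.Thm_1_9 M` (`Reconstruction.lean` :164–170) says: SOME `NFPortionAlgorithm` outputs, at every Thm-1.9
input curve of the model `M`, (a) the prescribed decomposition groups of NF-points and (d)(e) fields ISOMORPHIC to
`k̄_NF`, `K_{Z_NF}`.  The algorithm object `NFPortionAlgorithm` already CARRIES print's functoriality as typed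
transport `map : (E ≅ F) → (obj E).Iso (obj F)` (`map_id`, `map_comp`; `comap`, `comapBase`), but the comparison
binder does not say that the (e)-comparison with the model is COMPATIBLE with that transport.  Consequence
(acceptance critic crit-A W2 2026-08-28T21:30Z, adopted as ERRATA-L5 X-143): a witness may read its answers off
the model and transport by identities — `Thm_1_9 M` AS TYPED is MODEL-TRANSPARENT, so a downstream consumer that
needs the reconstructed `Π_X`-ACTION on `K_{Z_NF}` (GAP B, [IUTchI] Ex. 5.4 (iv), the residual `hEq` of
`InitialThetaData.C2Residuals'`) cannot derive it from `h₁₉` by name.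

THIS FILE (cure L-c of X-143: NEW declarations; `Thm_1_9` and every landed [AbsTopIII] file byte-identical):

* `CurveModel.NFGaloisAction M` — a MODEL-SIDE DATUM: at a family of recorded curves, the model's record of the
  natural `Π_U`-action on `K_{Z_NF} = M.NFFunctionField U` (print: `Π_X` acts through `Π_X ↠ G_k` on the
  `k̄_NF`-coefficients).  `CurveModel` itself records no such action (its fields stop at `NFFunctionField`), and
  forking the model type would fork every landed model; hence a separate datum (memo §(i), (β)).
* `NFPortionAlgorithm.InnerEquivariantAt A M ρ i` — the INNER-ISOMORPHISM instance of print's «functoriality with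
  respect to isomorphisms»: SOME comparison `φ : K_A(Π_X) ≃+* K_{X,NF}` intertwines the algorithm's transport along
  `innerIso g : (Π_X ↠ G_k) ≅ (Π_X ↠ G_k)` with the recorded action of `g`.  (Inner automorphisms ARE isomorphisms
  of the extension; at the genuine étale-`π₁` model the Kummer-theoretic algorithm of print is `Π_X`-equivariant in
  exactly this sense — Kummer classes in `lim_V H¹(Π_V, μ_Ẑ(Π_X))` are `Π_X`-equivariant and `Δ_X` acts trivially on
  classes of functions on `X_{k̄}` — so `Thm_1_9'` below is IMPLIED BY print's theorem at the intended model: a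
  weakening of print, never a strengthening beyond it.)
* `Thm_1_9'.WitnessedBy M ρ A` (the body, for a GIVEN algorithm, so that negatives can speak about classes of
  algorithms) and the named fact `Thm_1_9' M ρ := ∃ A, WitnessedBy M ρ A`; `Thm_1_9'.toThm_1_9`.
* NON-TRANSPARENCY (memo §(ii), the kernel form of X-143, stated about the WITNESS CLASS — never as
  «¬ Thm_1_9' (named model)», which would assert print's theorem false at our model):
  `NFPortionAlgorithm.IsInnerTrivialAt` («`map := id`»: the answer read off a representative of the isomorphism
  class of `E`), `not_innerEquivariantAt_of_isInnerTrivialAt`, `Thm_1_9'.not_witnessedBy_of_isInnerTrivialAt` —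
  PROVED: an inner-trivial algorithm witnesses `Thm_1_9'` at NO recorded input curve whose action moves one
  element.  (Contrast: the same algorithms DO witness `Thm_1_9`.)
* OPTIONAL constants conjunct (memo §(i) SIG-DELTA (i-d), RULINGS #356: adopted as a separate strengthening; the
  binder of record downstream is `Thm_1_9'`, unchanged): for the CONSTANT field `k̄_NF` the model DOES say what the
  action is (`M.galIso X` on `AlgebraicClosure (M.base X) ⊇ M.kbarNF X`), so that half of the clause is
  MODEL-INTRINSIC — `NFPortionAlgorithm.ConstEquivariantAt`, `Thm_1_9'.WitnessedByConst` (→ `WitnessedBy`),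
  `Thm_1_9c'`, and the NEG `not_constEquivariantAt_of_constEquiv_eq_refl` (PROVED, no `ρ` in sight).

WHAT THE CLAUSE CARRIES AND WHAT IT DOES NOT (L4 owner's note, abc-iut-c312-2 gen 13, co-sign 2026-08-28T23:12Z):
at a recorded curve whose action is the coefficient action through `Π ↠ G_k ≅ Gal(k̄/k)`, a witness must realise
`Inn(Π) → Gal(k̄/k) → Aut(K_{Z,NF})` compatibly with FUNCTORIAL transport on all isomorphisms of the extension —
content of Neukirch–Uchida type for the constant field, which no read-off algorithm supplies; it does NOT constrain
the transcendental part of `K_{Z,NF}` beyond the (e)-comparison (inner elements act through coefficients), and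
print's functoriality under OPEN INJECTIONS / base change (finite étale coverings, deck transformations) is not
compared with the model here — `CurveModel` has no morphisms between curves other than `res` (a later DATUM design).
ADMISSIBILITY: `Thm_1_9'` is a NAMED FACT relative to `(M, ρ)`, consumed downstream ONLY in instance form at a
named pair (abc-iut: `InitialThetaData.Thm19' G`); `∀ M ρ, Thm_1_9' M ρ` is refuted a fortiori by the tree's
`not_forall_thm_1_9` via `toThm_1_9` and is never used.

No `instance`, no notation, no axiom, no `sorry`; nothing of [AbsTopIII] is proved or refuted here (a strengthened
fact typed by name is a HYPOTHESIS); nothing here bears on the disputed [IUTchIII] Cor. 3.12 or asserts that abc is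
proved or refuted; typed ≠ inhabited ≠ proved-in-print.
-/

noncomputable section

open CategoryTheory
open scoped Pointwise

namespace Literature.AnabelianGeometry.AbsoluteAnabelian.AbsTopIII

universe u

/-! ### (i) The model-side datum and the inner-equivariance clause -/

/-- **Model-side datum for the functoriality clause of Thm. 1.9**: the model's RECORD of the natural `Π_U`-action on
`K_{Z_NF} = M.NFFunctionField U` (print: `K_{Z_NF}` is a `Π_X`-set through `Π_X ↠ G_k` acting on the
`k̄_NF`-coefficients) at a FAMILY of its curves `curve i`, `i : ι`, as ring endomorphisms `act i g`.  `CurveModel`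
records no such action, so the functoriality clause can only be compared with the model where the model SAYS what
its action is — this datum.  Laws of the action (`act i 1 = id`, multiplicativity) are the model's business and are
not needed by the clause or its negative below. [cite: MochizukiAbsTopIII2015, Thm 1.9 (d)(e) pp.37-38] -/
structure CurveModel.NFGaloisAction (M : CurveModel.{u}) : Type (u + 1) where
  /-- index of the recorded curves (universe `u`: e.g. a family indexed by the finite places of a number field) -/
  ι : Type u
  /-- the recorded curves -/
  curve : ι → M.Curve
  /-- `g ↦ (f ↦ f^g)`: the recorded action of `g ∈ Π_U` on `K_{Z_NF}` of the curve `U = curve i` -/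
  act : ∀ i, (M.ext (curve i)).arith → (M.NFFunctionField (curve i) →+* M.NFFunctionField (curve i))

/-- **The functoriality/equivariance clause of [AbsTopIII] Thm. 1.9 at one recorded curve** (the inner-isomorphism
instance of «functorial … with respect to … isomorphisms», p. 38; Rmk. 1.9.5 (i) p. 39): SOME comparison
`φ : K_A(Π_X) ≃+* K_{X,NF}` of the reconstructed function field with the model's intertwines the algorithm's
transport along the INNER isomorphism `innerIso g` of `Π_X ↠ G_k` (`A.map`, the typed functoriality of
`NFPortionAlgorithm`) with the model's recorded action of `g`.  Convention `innerIso g ↦ act i g` (not the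
inverse): the Kummer class of `g·f` is the `g`-conjugate of the Kummer class of `f`.
[cite: MochizukiAbsTopIII2015, Thm 1.9 p.38] -/
def NFPortionAlgorithm.InnerEquivariantAt (A : NFPortionAlgorithm.{u}) (M : CurveModel.{u})
    (ρ : M.NFGaloisAction) (i : ρ.ι) : Prop :=
  ∃ φ : (A.obj (M.ext (ρ.curve i))).functionField ≃+* M.NFFunctionField (ρ.curve i),
    ∀ (g : (M.ext (ρ.curve i)).arith) (x : (A.obj (M.ext (ρ.curve i))).functionField),
      φ ((A.map ((M.ext (ρ.curve i)).innerIso g)).funEquiv x) = ρ.act i g (φ x)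

/-- **The body of `Thm_1_9'` for a GIVEN algorithm `A`** (so that negatives can speak about classes of algorithms):
the three clauses (a), (d), (e) of `Thm_1_9 M` for `A` — VERBATIM `Reconstruction.lean` :165–170 — AND inner
equivariance at every recorded Thm-1.9 input curve of `ρ`. [cite: MochizukiAbsTopIII2015, Thm 1.9 pp.37-38] -/
def Thm_1_9'.WitnessedBy (M : CurveModel.{u}) (ρ : M.NFGaloisAction) (A : NFPortionAlgorithm.{u}) : Prop :=
  (∀ X : M.Curve, M.IsThm19Input X →
    (A.obj (M.ext X)).nfPointDecomp =
        {D | ∃ (x : M.Point X) (g : (M.ext X).arith),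
          M.IsNFPoint X x ∧ D = MulAut.conj g • M.decomp X x}
      ∧ Nonempty ((A.obj (M.ext X)).constField ≃+* M.kbarNF X)
      ∧ Nonempty ((A.obj (M.ext X)).functionField ≃+* M.NFFunctionField X))
  ∧ ∀ i : ρ.ι, M.IsThm19Input (ρ.curve i) → A.InnerEquivariantAt M ρ i

/-- **[AbsTopIII] Thm. 1.9 WITH its functoriality clause, comparison form relative to `(M, ρ)`** (cure L-c of
ERRATA-L5 X-143; a NEW declaration — `Thm_1_9` is untouched): «there exists a functorial "group-theoretic"
algorithm for reconstructing the "NF-portion of the function field" of `X` from the extension of profinite groups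
`1 → Δ_X → Π_X → G_k → 1`» (p. 37), the functoriality («with respect to arbitrary open injective homomorphisms of
extensions of profinite groups», p. 38) transcribed in its inner-isomorphism instance as equivariance of the
(e)-comparison at the curves where the model records its Galois action (`ρ`).  NAMED FACT relative to `(M, ρ)`
(intended `M` = étale `π₁`, `ρ` = the coefficient action); ADMISSIBLE downstream ONLY in instance form at a named
pair — `∀ M ρ` is refuted a fortiori by `not_forall_thm_1_9` via `Thm_1_9'.toThm_1_9`.  Typed as a hypothesis;
neither proved nor refuted here. [cite: MochizukiAbsTopIII2015, Thm 1.9 pp.37-38] -/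
def Thm_1_9' (M : CurveModel.{u}) (ρ : M.NFGaloisAction) : Prop :=
  ∃ A : NFPortionAlgorithm.{u}, Thm_1_9'.WitnessedBy M ρ A

/-- `Thm_1_9' M ρ → Thm_1_9 M`: nothing of the old binder is lost (the first conjunct of `WitnessedBy` IS the body
of `Thm_1_9`). [cite: MochizukiAbsTopIII2015, Thm 1.9 p.37] -/
theorem Thm_1_9'.toThm_1_9 {M : CurveModel.{u}} {ρ : M.NFGaloisAction} (h : Thm_1_9' M ρ) : Thm_1_9 M := by
  obtain ⟨A, hA, -⟩ := h
  exact ⟨A, hA⟩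

/-- A witness of `Thm_1_9'` is inner-equivariant at every recorded input curve (projection, by name).
[cite: MochizukiAbsTopIII2015, Thm 1.9 p.38] -/
theorem Thm_1_9'.WitnessedBy.innerEquivariantAt {M : CurveModel.{u}} {ρ : M.NFGaloisAction}
    {A : NFPortionAlgorithm.{u}} (h : Thm_1_9'.WitnessedBy M ρ A) (i : ρ.ι)
    (hin : M.IsThm19Input (ρ.curve i)) : A.InnerEquivariantAt M ρ i :=
  h.2 i hin

/-! ### (ii) Non-transparency: the kernel form of X-143, as a statement about the WITNESS CLASS -/

/-- **The transparency predicate**: an algorithm whose transport along every INNER isomorphism of `E` is the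
identity on its function-field output («`map := id`-style»: the answer read off a representative of the
isomorphism class of `E`).  Such algorithms can witness `Thm_1_9` (ERRATA-L5 X-143); the point of `Thm_1_9'` is
that they cannot witness IT. [cite: MochizukiAbsTopIII2015, Rmk 1.9.8 pp.40-41] -/
def NFPortionAlgorithm.IsInnerTrivialAt (A : NFPortionAlgorithm.{u}) (E : FundamentalExtension.{u}) : Prop :=
  ∀ g : E.arith, (A.map (E.innerIso g)).funEquiv = RingEquiv.refl _

/-- **NEG lemma (generic kernel form of X-143)**: an inner-trivial algorithm is inner-equivariant for NO comparison
`φ`, as soon as the recorded action moves one element.  So `Thm_1_9'` is NOT model-transparent relative to such a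
`ρ`: a witness must genuinely use the group element. [cite: MochizukiAbsTopIII2015, Rmk 1.9.5 (i) p.39] -/
theorem NFPortionAlgorithm.not_innerEquivariantAt_of_isInnerTrivialAt {A : NFPortionAlgorithm.{u}}
    {M : CurveModel.{u}} {ρ : M.NFGaloisAction} {i : ρ.ι} (hA : A.IsInnerTrivialAt (M.ext (ρ.curve i)))
    (hmove : ∃ (g : (M.ext (ρ.curve i)).arith) (f : M.NFFunctionField (ρ.curve i)), ρ.act i g f ≠ f) :
    ¬ A.InnerEquivariantAt M ρ i := by
  rintro ⟨φ, hφ⟩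
  obtain ⟨g, f, hf⟩ := hmove
  have h := hφ g (φ.symm f)
  rw [hA g, RingEquiv.refl_apply, RingEquiv.apply_symm_apply] at h
  exact hf h.symm

/-- **Corollary**: no inner-trivial algorithm WITNESSES `Thm_1_9'` at a recorded Thm-1.9 input curve whose action
moves something (the costume test of the X-143 cure: with `Thm_1_9` in place of `Thm_1_9'` the same algorithms pass).
[cite: MochizukiAbsTopIII2015, Rmk 1.9.5 (i) p.39] -/
theorem Thm_1_9'.not_witnessedBy_of_isInnerTrivialAt {A : NFPortionAlgorithm.{u}} {M : CurveModel.{u}}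
    {ρ : M.NFGaloisAction} (i : ρ.ι) (hin : M.IsThm19Input (ρ.curve i))
    (hA : A.IsInnerTrivialAt (M.ext (ρ.curve i)))
    (hmove : ∃ (g : (M.ext (ρ.curve i)).arith) (f : M.NFFunctionField (ρ.curve i)), ρ.act i g f ≠ f) :
    ¬ Thm_1_9'.WitnessedBy M ρ A := fun h =>
  NFPortionAlgorithm.not_innerEquivariantAt_of_isInnerTrivialAt hA hmove (h.2 i hin)

/-! ### (i-d) OPTIONAL constants conjunct — model-intrinsic (no `ρ`): the `k̄_NF` half of the clause -/

/-- **Constants-equivariance at a curve `X`, read off the model itself**: SOME comparison `e : k̄_A ≃+* k̄_NF` of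
the reconstructed constant field intertwines the algorithm's transport along INNER isomorphisms (`constEquiv`
component of `A.map (innerIso g)`) with the Galois element `galIso (aug g) ∈ Gal(k̄/k)` acting on
`k̄ = AlgebraicClosure (M.base X) ⊇ k̄_NF`.  Same convention as `InnerEquivariantAt` (`innerIso g ↦ aug g`).
[cite: MochizukiAbsTopIII2015, Thm 1.9 (d)(e) pp.37-38] -/
def NFPortionAlgorithm.ConstEquivariantAt (A : NFPortionAlgorithm.{u}) (M : CurveModel.{u}) (X : M.Curve) :
    Prop :=
  ∃ e : (A.obj (M.ext X)).constField ≃+* M.kbarNF X,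
    ∀ (g : (M.ext X).arith) (c : (A.obj (M.ext X)).constField),
      ((e ((A.map ((M.ext X).innerIso g)).constEquiv c) : M.kbarNF X) : AlgebraicClosure (M.base X)) =
        Field.absoluteGaloisGroup.toAlgEquiv (M.base X) ((M.galIso X).hom.hom ((M.ext X).aug g))
          ((e c : M.kbarNF X) : AlgebraicClosure (M.base X))

/-- **The body of `Thm_1_9'` with the constants conjunct**: `WitnessedBy` AND constants-equivariance at every
Thm-1.9 input curve (model-intrinsic). [cite: MochizukiAbsTopIII2015, Thm 1.9 (d)(e) pp.37-38] -/
def Thm_1_9'.WitnessedByConst (M : CurveModel.{u}) (ρ : M.NFGaloisAction) (A : NFPortionAlgorithm.{u}) : Prop :=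
  Thm_1_9'.WitnessedBy M ρ A ∧ ∀ X : M.Curve, M.IsThm19Input X → A.ConstEquivariantAt M X

/-- Monotonicity: the body with the constants conjunct implies the body of record.
[cite: MochizukiAbsTopIII2015, Thm 1.9 p.37] -/
theorem Thm_1_9'.WitnessedByConst.toWitnessedBy {M : CurveModel.{u}} {ρ : M.NFGaloisAction}
    {A : NFPortionAlgorithm.{u}} (h : Thm_1_9'.WitnessedByConst M ρ A) : Thm_1_9'.WitnessedBy M ρ A :=
  h.1

/-- **`Thm_1_9c'` — the OPTIONAL stronger named fact** (Thm. 1.9 with the inner-equivariance clause on BOTH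
reconstructed fields: `K_{Z_NF}` relative to `ρ`, `k̄_NF` model-intrinsically).  Offered, not the binder of record;
instance form only. [cite: MochizukiAbsTopIII2015, Thm 1.9 (d)(e) pp.37-38] -/
def Thm_1_9c' (M : CurveModel.{u}) (ρ : M.NFGaloisAction) : Prop :=
  ∃ A : NFPortionAlgorithm.{u}, Thm_1_9'.WitnessedByConst M ρ A

/-- `Thm_1_9c' M ρ → Thm_1_9' M ρ`. [cite: MochizukiAbsTopIII2015, Thm 1.9 p.37] -/
theorem Thm_1_9c'.toThm_1_9' {M : CurveModel.{u}} {ρ : M.NFGaloisAction} (h : Thm_1_9c' M ρ) : Thm_1_9' M ρ := by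
  obtain ⟨A, hA⟩ := h
  exact ⟨A, hA.toWitnessedBy⟩

/-- **NEG, model-intrinsic kernel form of X-143 for the constants**: an algorithm whose inner transport is trivial
on its CONSTANT field is constants-equivariant for NO comparison `e`, at any curve where the model's Galois action
moves one element of `k̄_NF` — no `ρ` in sight. [cite: MochizukiAbsTopIII2015, Rmk 1.9.5 (i) p.39] -/
theorem NFPortionAlgorithm.not_constEquivariantAt_of_constEquiv_eq_refl {A : NFPortionAlgorithm.{u}}
    {M : CurveModel.{u}} {X : M.Curve}
    (hA : ∀ g : (M.ext X).arith, (A.map ((M.ext X).innerIso g)).constEquiv = RingEquiv.refl _)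
    (hmove : ∃ (g : (M.ext X).arith) (y : M.kbarNF X),
      Field.absoluteGaloisGroup.toAlgEquiv (M.base X) ((M.galIso X).hom.hom ((M.ext X).aug g))
        (y : AlgebraicClosure (M.base X)) ≠ y) :
    ¬ A.ConstEquivariantAt M X := by
  rintro ⟨e, he⟩
  obtain ⟨g, y, hy⟩ := hmove
  have h := he g (e.symm y)
  rw [hA g, RingEquiv.refl_apply, RingEquiv.apply_symm_apply] at h
  exact hy h.symm

/-- The constants conjunct is witnessed by NO algorithm that is inner-trivial on constants at a recorded input
curve where the Galois action moves an element of `k̄_NF`. [cite: MochizukiAbsTopIII2015, Rmk 1.9.5 (i) p.39] -/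
theorem Thm_1_9'.not_witnessedByConst_of_constEquiv_eq_refl {A : NFPortionAlgorithm.{u}} {M : CurveModel.{u}}
    {ρ : M.NFGaloisAction} (X : M.Curve) (hin : M.IsThm19Input X)
    (hA : ∀ g : (M.ext X).arith, (A.map ((M.ext X).innerIso g)).constEquiv = RingEquiv.refl _)
    (hmove : ∃ (g : (M.ext X).arith) (y : M.kbarNF X),
      Field.absoluteGaloisGroup.toAlgEquiv (M.base X) ((M.galIso X).hom.hom ((M.ext X).aug g))
        (y : AlgebraicClosure (M.base X)) ≠ y) :
    ¬ Thm_1_9'.WitnessedByConst M ρ A := fun h =>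
  NFPortionAlgorithm.not_constEquivariantAt_of_constEquiv_eq_refl hA hmove (h.2 X hin)

end Literature.AnabelianGeometry.AbsoluteAnabelian.AbsTopIII

end
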